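import Summits.CriticalPhenomena.PercolationContinuityZ3.Theorems.PercNearOneGluingNoHeavyLowerTailQ44VertexCoverLawW
import HarnessLib
import HarnessLib.Audit.Tags

/-!
# The open statement behind Conjecture W for all graphs: block terminal-edge dominance (TD_W)

Support file for crux `stmt-CriticalPhenomena-4575`, seat `prim-bnk-1` gen 40; memo `run/shared/lean/prim/prim-l12/FROM-prim-bnk-1-gen40-FIBRE-BRIDGE.md`.
`BlockTDW` (`@[conjecture]`): every two-copy block table maps `kerW` into the 35-ray terminal-edge cone.  Certified (exact rational
certificates) for all blocks whose non-terminal part has ≤ 4 vertices (gen 39), 0 failures on ≈ 2·10⁶ + 1.8·10⁸ larger blocks; OPEN.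
`q44_cells_of_blockTD : BlockTDW → Conjecture W for every finite weighted graph` (via `VCCone.sum_kerW_cell_nonneg_of_goodBlocks` with one block).
No sorries, no named facts; standard axioms.
-/

namespace Summit.CriticalPhenomena.PercolationContinuityZ3.Theorems

namespace VCCone

open TwoCopyMono FourPointAtoms

variable {n : ℕ}

/-! ## The open statement: block TT-dominance -/

/-- **CONJECTURE TD_W (block terminal-edge dominance for `W`).**  For every `n`, all pairwise distinct marked points and EVERY
two-copy block (free pairs `Mb`, contracted pairs `Cb` — any finite sets of pairs), the block table maps `kerW` into the 35-ray
terminal-edge cone: `InCone raysW (tact (blockTab a b c y Mb Cb) kerW)`.  OPEN.  Proved (exact certificates) for all blocks whose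
non-terminal part has ≤ 4 vertices (memo gen 39 §2; in Lean: stars `…Q44TTConeStarOpsW`, simple components with ≤ 3 internal
vertices `…Q44TTConeLevel2W/Level3Wp*`); 0 failures on ≈ 2·10⁶ (seat) + 1.8·10⁸ (ttrl, exact) larger blocks.  By the general
socket it implies Conjecture W for ALL finite weighted graphs (`q44_cells_of_blockTD`). [this work] -/
@[conjecture] def BlockTDW : Prop :=
  ∀ (n : ℕ) (a b c y : Fin n), Function.Injective (quad a b c y) →
    ∀ Mb Cb : Finset (Sym2 (Fin n)), InCone raysW (tact (blockTab a b c y Mb Cb) kerW)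

/-- **TD_W ⟹ CONJECTURE W for every finite weighted graph** (all `n`, pairwise distinct marked points). [this work] -/
theorem q44_cells_of_blockTD (hTD : BlockTDW) (a b c y : Fin n) (hq : Function.Injective (quad a b c y))
    (w : Sym2 (Fin n) → unitInterval) :
    2 * (cell w a b c y 11 * cell w a b c y 9 + cell w a b c y 11 * cell w a b c y 8 + cell w a b c y 6 * cell w a b c y 8 +
        cell w a b c y 6 * cell w a b c y 1 + cell w a b c y 1 * cell w a b c y 8) +
      (cell w a b c y 2 * cell w a b c y 13 + cell w a b c y 1 * cell w a b c y 13 + cell w a b c y 5 * cell w a b c y 12 +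
        cell w a b c y 1 * cell w a b c y 12 + cell w a b c y 6 * cell w a b c y 10 + cell w a b c y 6 * cell w a b c y 7 +
        cell w a b c y 2 * cell w a b c y 10 + cell w a b c y 5 * cell w a b c y 7) ≤
      2 * ((cell w a b c y 11 + cell w a b c y 14) * cell w a b c y 0) := by
  classical
  refine q44_cells_of_kerW_form w a b c y
    (sum_kerW_cell_nonneg_of_goodBlocks a b c y hq w (fun _ => ()) (fun e e' _ _ hne => ?_) fun M C _ _ l _ => ?_)
  · exact absurd rfl hne
  · -- one block: `M.filter (fun _ => () = ()) = M`
    rw [Finset.filter_true_of_mem fun e _ => rfl, Finset.filter_true_of_mem fun e _ => rfl]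
    exact hTD n a b c y hq M C

end VCCone

end Summit.CriticalPhenomena.PercolationContinuityZ3.Theorems
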